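/-
Copyright (c) 2026 the pub-hodgecm-mathlib formalisation cell (harness21).  Prover seat hodgecm-mathlib-F0P2-p09 (g0) (Track A «FOUR-FRAME», re-dealt to strike line L1 ∕
Track B «K2-LIT», hLiu418 = stmt-HodgeConjecture-24832): socket #42S, organ (S5-c) — STEP 1 of the constant-term letters payer: THE CONSTANT TERM OF A #41 CONTINUATION
ON THE WHOLE WINDOW `{0 < re}` from the KIND-0 organ outputs (LEAD F0P6-plan (g14) RULING M-158h (b)).  THEOREMS ONLY (no `def`, no `instance`, no notation,
no named-fact hypothesis, no `sorry`).
-/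
import Summits.HodgeConjecture.HodgeConjecture.Theorems.K2LiuSiegelEisensteinResidueCoefficients     -- ★ I5 file 1: `eqOn_halfPlane_of_eqOn_right`, `curveFrame_pos`; brings ★ W3-a, ★ ed. 4a′
import Summits.HodgeConjecture.HodgeConjecture.Theorems.K2LiuSiegelEisensteinConstantTermPackage      -- ★ ed. 4a `fourierCoeffDelta_zero_three_cells`
import HarnessLib

/-!
# Crux `HLiu418`, socket #42S, organ (S5-c), step 1: THE CONSTANT TERM OF A POLE-CLEARED CONTINUATION `(P, Es)` ON `{0 < re}` —
# `(Es s)_0(h) = (∏_{p∈P}(s−p))·f_s(h) + (∏_{p∈R}(s−p))·(E₈ s h + E₇ s h)`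

Cell `hodgecm-mathlib`, crux item hLiu418 = `stmt-HodgeConjecture-24832`; squad K2, LEAD F0P6-plan (g14); prover F0P2-p09 (g0).  Lane
`--supports stmt-HodgeConjecture-24832 --as helper` (count-neutral).

For a standard family `f` (★ `IsStandardSectionFamily`), a Fourier carrier `(νN, β ≤ 𝟙_K)`, a pole-cleared continuation `(P, Es)` of `E(s, f)` with socket #41's (A1)(A2)(A4)(A5),
and the KIND-0 ORGAN OUTPUTS BY VALUE in the currency of ★ `K2LiuSiegelEisensteinConstantTermPackage.exists_constantTerm_package` with pole prefix `∏_{p∈Q}(s−p)` —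
the big-cell package `E₈` ((i) holomorphy, (iv) `E₈ s h = (∏_Q(s−p))·(∫β)⁻¹·M(s)f_s(h)` on `{n∕2 < re}`) and the middle package `E₇` ((i), (iv) w.r.t. `(∫β)⁻¹·MID(s,h)`) — and a
splitting `∏_P = ∏_R · ∏_Q` of the prefix (e.g. `Q = {½}`, `R = P ∖ {½}` when `½ ∈ P`): the `S = 0` Fourier coefficient of `Es s` equals
`(∏_P(s−p))·f_s(h) + (∏_R(s−p))·(E₈ s h + E₇ s h)` for EVERY `s` with `0 < re s` — ★ O41.4∕ed. 4a three cells on `{n∕2 < re}` (O41.4's (H) paid by ★ ed. 4a′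
`lintegral_tsum_enorm_mul_weight_ne_top`), ★ W3-a `differentiableOn_fourierCoeffDelta_halfPlane` and the identity theorem ★ `eqOn_halfPlane_of_eqOn_right`.  This is the
mechanism of ★ I5 `coeff_eq_prod_mul_whittaker` at the index `S = 0`; at `s = ½ ∈ P` the identity cell drops out, which is what the (S5-c) letters use.
References: [MoeglinWaldspurger1995, II.1.7, IV.1.9–IV.1.11]; [Tan1999, §4 Props. 4.1, 4.8]; [KudlaRallis1994, §1].
HONEST LABEL.  Count-neutral helper: `HC_CM` is proved only modulo the 7 printed citations (2 remaining named inputs: hLiu418 = `stmt-HodgeConjecture-24832`,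
h413 = `stmt-HodgeConjecture-24833`) until rung 0 closes.
-/

set_option autoImplicit false
set_option linter.dupNamespace false -- the mandated namespace repeats `HodgeConjecture.HodgeConjecture`

noncomputable section

open scoped Matrix Topology ENNReal NNReal BigOperators
open NumberField IsDedekindDomain MeasureTheory Filter
open Literature.NumberTheory.Automorphic Literature.NumberTheory.GaloisRepresentations
open Literature.NumberTheory.GelbartRogawski1991 Literature.NumberTheory.GelbartRogawski1991.GRConstruction
open Literature.NumberTheory.K2Lit.SiegelDoubled Literature.MeasureTheory.Group

namespace Summit.HodgeConjecture.HodgeConjecture.Cruxes.HLiu418.K2LiuContinuedConstantTermCells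

open K2LiuSiegelUnipotentFourierDefs
open K2LiuSiegelEisensteinResidueCoefficients (eqOn_halfPlane_of_eqOn_right curveFrame_pos)
open K2LiuContinuedFamilyUnipotentIntegralsHolomorphic (differentiableOn_fourierCoeffDelta_halfPlane)
open K2LiuSiegelEisensteinConstantTermFiniteness (lintegral_tsum_enorm_mul_weight_ne_top)
open K2LiuSiegelEisensteinConstantTermPackage (fourierCoeffDelta_zero_three_cells)
open K2LiuFourierCoeffContinuedEuler (fourierCoeffDelta_const_mul fourierCoeffDelta_congr)
open K2LiuSiegelEisensteinWhittakerTermPackage (differentiable_poleClearing)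

variable (L : Type) [Field L] [NumberField L] [IsCMField L] {n : ℕ} (e : Fin 2 × Fin 1 ≃ Fin n)
  (dV : Fin 2 → L) (hdV : ∀ i, IsCMField.complexConj L (dV i) = dV i)
  (dW : Fin 1 → L) (hdW : ∀ i, IsCMField.complexConj L (dW i) = dW i)

/-- **THE CONSTANT TERM OF A CONTINUATION ON THE WHOLE WINDOW.**  For a standard family `f`, a carrier `(νN, β ≤ 𝟙_K)`, a pole-cleared continuation `(P, Es)` with
(A1)(A2)(A4)(A5), the KIND-0 organ outputs `E₈`, `E₇` (★ ed. 4a currency, prefix `∏_Q`) and a splitting `∏_P = ∏_R·∏_Q`: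
`(Es s)_0(h) = (∏_P(s−p))·f_s(h) + (∏_R(s−p))·(E₈ s h + E₇ s h)` for every `0 < re s`. [cite: MoeglinWaldspurger1995, II.1.7, IV.1.9–IV.1.11] [cite: Tan1999, §4 Prop. 4.8] -/
theorem constTerm_continuation_eq_cells (hdV0 : ∀ i, dV i ≠ 0) (hdW0 : ∀ i, dW i ≠ 0)
    (𝒦 : IwasawaDatum L e dV hdV dW hdW) {χ : HeckeCharacter L} (hχ : χ.IsUnitary) (f : ℂ → HA L e dV hdV dW hdW → ℂ)
    (hstd : IsStandardSectionFamily 𝒦 χ f) (hcont : ∀ s, Continuous (f s))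
    (wq : unipDeltaRat L e dV hdV dW hdW → ratH L e dV hdV dW hdW)
    (hwq : ∀ ν, ((wq ν : ratH L e dV hdV dW hdW) : HA L e dV hdV dW hdW) = weylDelta L e dV hdV dW hdW * ((ν : unipDelta L e dV hdV dW hdW) : HA L e dV hdV dW hdW))
    [MeasurableSpace (unipDelta L e dV hdV dW hdW)] [BorelSpace (unipDelta L e dV hdV dW hdW)] (νN : Measure (unipDelta L e dV hdV dW hdW)) [νN.IsHaarMeasure]
    {β : unipDelta L e dV hdV dW hdW → ℝ≥0∞} (hβ : IsCoveringWeight (unipDeltaRat L e dV hdV dW hdW) β) (hβ0 : ∫⁻ u, β u ∂νN ≠ 0) (hβtop : ∫⁻ u, β u ∂νN ≠ ∞)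
    {K : Set (unipDelta L e dV hdV dW hdW)} (hK : IsCompact K) (hβK : ∀ u, β u ≤ K.indicator 1 u)
    (P : Finset ℂ) (Es : ℂ → HA L e dV hdV dW hdW → ℂ)
    (hA1 : ∀ h : HA L e dV hdV dW hdW, DifferentiableOn ℂ (fun s => Es s h) {s : ℂ | 0 < s.re})
    (hA2 : ∀ s : ℂ, 0 < s.re → Continuous (Es s))
    (hA4 : ∀ (s : ℂ) (h : HA L e dV hdV dW hdW), (n : ℝ) / 2 < s.re → Es s h = (∏ p ∈ P, (s - p)) * eisensteinFamilyDelta L e dV hdV dW hdW f s h)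
    (hA5 : ∀ z : ℂ, 0 < z.re → ∃ C A r : ℝ, 0 < r ∧ ∀ s : ℂ, dist s z < r → ∀ h : HA L e dV hdV dW hdW,
      ‖Es s h‖ ≤ C * adelicHeightGL (n + n) L (h : GL (Fin (n + n)) (AdeleRing (𝓞 L) L)) ^ A)
    -- the KIND-0 organ outputs BY VALUE (★ ed. 4a currency, pole prefix `Q`)
    (Q R : Finset ℂ) (hPQ : ∀ s : ℂ, (∏ p ∈ P, (s - p)) = (∏ p ∈ R, (s - p)) * ∏ p ∈ Q, (s - p))
    (E₈ : ℂ → HA L e dV hdV dW hdW → ℂ) (h8d : ∀ h : HA L e dV hdV dW hdW, DifferentiableOn ℂ (fun s => E₈ s h) {s : ℂ | 0 < s.re})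
    (h8eq : ∀ (s : ℂ) (h : HA L e dV hdV dW hdW), (n : ℝ) / 2 < s.re →
      E₈ s h = (∏ p ∈ Q, (s - p)) * (((∫⁻ u, β u ∂νN).toReal⁻¹ : ℝ) • intertwiningDelta L e dV hdV dW hdW νN (f s) h))
    (E₇ : ℂ → HA L e dV hdV dW hdW → ℂ) (h7d : ∀ h : HA L e dV hdV dW hdW, DifferentiableOn ℂ (fun s => E₇ s h) {s : ℂ | 0 < s.re})
    (h7eq : ∀ (s : ℂ) (h : HA L e dV hdV dW hdW), (n : ℝ) / 2 < s.re →
      E₇ s h = (∏ p ∈ Q, (s - p)) * (((∫⁻ u, β u ∂νN).toReal⁻¹ : ℝ) • ∫ u, (β u).toReal •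
        (∑' q : ↥(({Quotient.mk (MulAction.orbitRel (siegelDeltaRat L e dV hdV dW hdW) (ratH L e dV hdV dW hdW)) 1} ∪
            Set.range (fun ν : unipDeltaRat L e dV hdV dW hdW =>
              (Quotient.mk (MulAction.orbitRel (siegelDeltaRat L e dV hdV dW hdW) (ratH L e dV hdV dW hdW)) (wq ν) :
                SiegelDeltaQuot L e dV hdV dW hdW)))ᶜ : Set (SiegelDeltaQuot L e dV hdV dW hdW)),
          f s ((((Quotient.out (q : SiegelDeltaQuot L e dV hdV dW hdW) : ratH L e dV hdV dW hdW) : HA L e dV hdV dW hdW)) *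
            ((u : HA L e dV hdV dW hdW) * h))) ∂νN))
    (h : HA L e dV hdV dW hdW) :
    ∀ s : ℂ, 0 < s.re → fourierCoeffDelta L e dV hdV dW hdW νN β 0 (Es s) h =
      (∏ p ∈ P, (s - p)) * f s h + (∏ p ∈ R, (s - p)) * (E₈ s h + E₇ s h) := by
  have hn : 0 < n := curveFrame_pos e
  have hβK' : ∀ u, β u ≠ 0 → u ∈ K := fun u hu => by
    by_contra hK'
    have := hβK u
    rw [Set.indicator_of_notMem hK'] at this
    exact hu (le_antisymm this bot_le)
  refine eqOn_halfPlane_of_eqOn_right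
    (differentiableOn_fourierCoeffDelta_halfPlane L e dV hdV dW hdW hn νN hβ.measurable hβtop hK hβK' Es hA1 hA2 hA5 _ h)
    ((((differentiable_poleClearing P).differentiableOn.mul (hstd.1.2 h).differentiableOn)).add
      ((differentiable_poleClearing R).differentiableOn.mul ((h8d h).add (h7d h))))
    (by positivity : (0 : ℝ) ≤ (n : ℝ) / 2) fun s hs => ?_
  -- on `{n∕2 < re}`: unfold `Es s = ∏·E(s,f)`, pull the scalar, the three cells, the organ clauses
  have hslice : ∀ u : unipDelta L e dV hdV dW hdW, Es s (((u : unipDelta L e dV hdV dW hdW) : HA L e dV hdV dW hdW) * h) =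
      (∏ p ∈ P, (s - p)) * eisensteinFamilyDelta L e dV hdV dW hdW f s (((u : unipDelta L e dV hdV dW hdW) : HA L e dV hdV dW hdW) * h) := fun u => hA4 s _ hs
  rw [fourierCoeffDelta_congr L e dV hdV dW hdW νN β _ (φ' := fun x => (∏ p ∈ P, (s - p)) * eisensteinFamilyDelta L e dV hdV dW hdW f s x) hslice,
    fourierCoeffDelta_const_mul, show eisensteinFamilyDelta L e dV hdV dW hdW f s = eisensteinSeriesDelta L e dV hdV dW hdW (f s) from rfl,
    fourierCoeffDelta_zero_three_cells L e dV hdV dW hdW hn νN hβ hβ0 hβtop wq hwq (hstd.1.1 s) (hcont s) h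
      (lintegral_tsum_enorm_mul_weight_ne_top L e dV hdV dW hdW hdV0 hdW0 hχ hs (hstd.1.1 s) (hcont s) νN hβtop hK hβK h),
    h8eq s h hs, h7eq s h hs, hPQ s]
  ring

end Summit.HodgeConjecture.HodgeConjecture.Cruxes.HLiu418.K2LiuContinuedConstantTermCells

end
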